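import Mathlib.NumberTheory.Real.Irrational
import Mathlib.Analysis.SpecialFunctions.Pow.Real
import Mathlib.Algebra.Order.Floor.Defs
import Mathlib.Algebra.BigOperators.Fin
import HarnessLib

/-!
# The words of Limaye–Srinivasan–Tavenas: letters `⌊k/√2⌋` and `-k`, Claim 17, unbiasedness

(N. Limaye, S. Srinivasan, S. Tavenas, *Superpolynomial lower bounds against low-depth algebraic
circuits*, J. ACM 72 (2025), Art. 26 = FOCS 2021, §2 (words, `w_S`, `b`-unbiased words), §5
(Claim 16: words over the alphabet `{⌊αk⌋, -k}`, `α = 1/√2`; Claim 17: a Diophantine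
approximation bound), proof of Lemma 13 / Lemma 15 (greedy construction of a `k`-unbiased word).)

A *word* of length `d` over the alphabet `{⌊k/√2⌋, -k}` is encoded by its sign pattern
`pos : Fin d → Bool`; the letter at position `i` is `wt k pos i = ⌊k/√2⌋` if `pos i` and `-k`
otherwise, and `wsum k pos S = ∑_{i ∈ S} wt k pos i` is LST's `w_S`.

## Content (all proved)

* `posLetter k = ⌊k/√2⌋` and its estimates (`posLetter_le`, `posLetter_le_div`,
  `sub_one_lt_posLetter`).
* **Claim 17** (`abs_sub_ge_claim17`): for naturals `p, q` not both zero,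
  `|p/√2 - q| ≥ 1/(4p/√2 + 2)` (from the irrationality of `√2`).
* `abs_wsum_ge` — the consequence used in the proof of Claim 16 (p. 26:14–26:15): for every
  nonempty block set `S`, `|w_S| ≥ k/(5 #S) - #S`.
* `abs_wt_le`, `abs_wsum_le` — `|w_i| ≤ k`, `|w_S| ≤ k #S`.
* The **greedy `k`-unbiased word** `greedyWord d k` ("if `w_{[i]} ≤ 0` we choose
  `w_{i+1} = ⌊αk⌋`, otherwise `w_{i+1} = -k`", proof of Lemma 13, p. 26:12): all its prefix sums
  lie in `[-k, k]` (`abs_prefixSum_greedyWord_le`).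

Pure arithmetic; no polynomials or circuits here. Everything lives in the sub-namespace
`Literature.Computability.AlgebraicComplexity.LSTWord` (the short names `wt`, `wsum`, … are
too generic for the shared topic namespace).

## References

* N. Limaye, S. Srinivasan, S. Tavenas, J. ACM 72 (2025), Art. 26, §2, Claim 16, Claim 17
  (p. 26:14), proofs of Lemma 13 (p. 26:12) and Lemma 15 (p. 26:14).
-/

noncomputable section

open Finset

namespace Literature.Computability.AlgebraicComplexity

namespace LSTWord

/-! ### The letters -/

/-- The positive letter `⌊k/√2⌋ = ⌊αk⌋`, `α = 1/√2` (LST 2025, Claim 16).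
[cite: LimayeSrinivasanTavenas2025, Claim 16] -/
def posLetter (k : ℕ) : ℕ := ⌊(k : ℝ) / Real.sqrt 2⌋₊

/-- The signed letter at position `i` of the word with sign pattern `pos`: `⌊k/√2⌋` or `-k`
(LST 2025, §2 and Claim 16). [cite: LimayeSrinivasanTavenas2025, Claim 16] -/
def wt {d : ℕ} (k : ℕ) (pos : Fin d → Bool) (i : Fin d) : ℤ :=
  if pos i then (posLetter k : ℤ) else -(k : ℤ)

/-- `w_S = ∑_{i ∈ S} w_i` (LST 2025, §2). [cite: LimayeSrinivasanTavenas2025, §2] -/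
def wsum {d : ℕ} (k : ℕ) (pos : Fin d → Bool) (S : Finset (Fin d)) : ℤ :=
  ∑ i ∈ S, wt k pos i

/-- The unsigned letter size `|w_i|`: `⌊k/√2⌋` for positive, `k` for negative positions; the
block `X(w_i)` has `2^{|w_i|}` variables (LST 2025, §2). [cite: LimayeSrinivasanTavenas2025, §2] -/
def letterSize {d : ℕ} (k : ℕ) (pos : Fin d → Bool) (i : Fin d) : ℕ :=
  if pos i then posLetter k else k

section Letters

/-- `√2 > 0`. [folklore] -/
theorem sqrt_two_pos : (0 : ℝ) < Real.sqrt 2 := Real.sqrt_pos.2 (by norm_num)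

/-- `1 < √2`. [folklore] -/
theorem one_lt_sqrt_two : (1 : ℝ) < Real.sqrt 2 := by
  rw [show (1 : ℝ) = Real.sqrt 1 from Real.sqrt_one.symm]
  exact Real.sqrt_lt_sqrt (by norm_num) (by norm_num)

/-- `4/3 < √2`. [folklore] -/
theorem four_thirds_lt_sqrt_two : (4 / 3 : ℝ) < Real.sqrt 2 := by
  rw [Real.lt_sqrt (by norm_num)]
  norm_num

/-- `⌊k/√2⌋ ≤ k/√2`. [folklore] -/
theorem posLetter_le_div (k : ℕ) : (posLetter k : ℝ) ≤ k / Real.sqrt 2 :=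
  Nat.floor_le (div_nonneg (Nat.cast_nonneg k) sqrt_two_pos.le)

/-- `k/√2 - 1 < ⌊k/√2⌋`. [folklore] -/
theorem sub_one_lt_posLetter (k : ℕ) : (k : ℝ) / Real.sqrt 2 - 1 < posLetter k :=
  Nat.sub_one_lt_floor _

/-- `⌊k/√2⌋ ≤ k`. [cite: LimayeSrinivasanTavenas2025, Claim 16] -/
theorem posLetter_le (k : ℕ) : posLetter k ≤ k := by
  have h : (posLetter k : ℝ) ≤ k := by
    refine (posLetter_le_div k).trans ?_
    rw [div_le_iff₀ sqrt_two_pos]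
    nlinarith [one_lt_sqrt_two, Nat.cast_nonneg (α := ℝ) k]
  exact_mod_cast h

/-- `|w_i| ≤ k` as an integer bound. [cite: LimayeSrinivasanTavenas2025, §2] -/
theorem abs_wt_le {d : ℕ} (k : ℕ) (pos : Fin d → Bool) (i : Fin d) : |wt k pos i| ≤ k := by
  unfold wt
  split_ifs
  · rw [abs_of_nonneg (by positivity)]
    exact_mod_cast posLetter_le k
  · rw [abs_neg, abs_of_nonneg (by positivity)]

/-- `|w_S| ≤ k · #S`. [cite: LimayeSrinivasanTavenas2025, §2] -/
theorem abs_wsum_le {d : ℕ} (k : ℕ) (pos : Fin d → Bool) (S : Finset (Fin d)) :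
    |wsum k pos S| ≤ k * S.card := by
  unfold wsum
  refine (Finset.abs_sum_le_sum_abs _ _).trans ?_
  calc ∑ i ∈ S, |wt k pos i| ≤ ∑ _i ∈ S, (k : ℤ) := Finset.sum_le_sum fun i _ => abs_wt_le k pos i
    _ = k * S.card := by rw [Finset.sum_const, nsmul_eq_mul, mul_comm]

/-- The letter at `i` in terms of the letter size: `w_i = ± |w_i|`.
[cite: LimayeSrinivasanTavenas2025, §2] -/
theorem wt_eq {d : ℕ} (k : ℕ) (pos : Fin d → Bool) (i : Fin d) :
    wt k pos i = if pos i then (letterSize k pos i : ℤ) else -(letterSize k pos i : ℤ) := by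
  unfold wt letterSize
  split_ifs <;> rfl

/-- `w_S` splits as (positive letters) minus (negative letters):
`w_S = #S⁺ · ⌊k/√2⌋ - #S⁻ · k`. [cite: LimayeSrinivasanTavenas2025, Claim 16] -/
theorem wsum_eq_card_sub_card {d : ℕ} (k : ℕ) (pos : Fin d → Bool) (S : Finset (Fin d)) :
    wsum k pos S = (S.filter fun i => pos i).card * (posLetter k : ℤ) -
      (S.filter fun i => !pos i).card * (k : ℤ) := by
  unfold wsum
  rw [← Finset.sum_filter_add_sum_filter_not S (fun i => pos i = true)]
  have h1 : ∑ i ∈ S.filter (fun i => pos i = true), wt k pos i =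
      (S.filter fun i => pos i).card * (posLetter k : ℤ) := by
    rw [Finset.sum_congr rfl (g := fun _ => (posLetter k : ℤ)), Finset.sum_const, nsmul_eq_mul]
    intro i hi
    rw [Finset.mem_filter] at hi
    simp [wt, hi.2]
  have h2 : ∑ i ∈ S.filter (fun i => ¬ pos i = true), wt k pos i =
      -((S.filter fun i => !pos i).card * (k : ℤ)) := by
    have hf : S.filter (fun i => ¬ pos i = true) = S.filter (fun i => !pos i) := by
      ext i; simp
    rw [hf, Finset.sum_congr rfl (g := fun _ => -(k : ℤ)), Finset.sum_const, nsmul_eq_mul,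
      mul_neg, neg_inj]
    intro i hi
    rw [Finset.mem_filter] at hi
    have : pos i = false := by simpa using hi.2
    simp [wt, this]
  rw [h1, h2, sub_eq_add_neg]

/-- The letter sizes over `S` sum to `#S⁺ · ⌊k/√2⌋ + #S⁻ · k` (the exponent of
`|M^P| · |M^N| = 2^{∑ |w_i|}`). [cite: LimayeSrinivasanTavenas2025, §2.1] -/
theorem sum_letterSize_eq {d : ℕ} (k : ℕ) (pos : Fin d → Bool) (S : Finset (Fin d)) :
    ∑ i ∈ S, letterSize k pos i = (S.filter fun i => pos i).card * posLetter k +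
      (S.filter fun i => !pos i).card * k := by
  rw [← Finset.sum_filter_add_sum_filter_not S (fun i => pos i = true)]
  have hf : S.filter (fun i => ¬ pos i = true) = S.filter (fun i => !pos i) := by
    ext i; simp
  rw [hf]
  congr 1
  · rw [Finset.sum_congr rfl (g := fun _ => posLetter k), Finset.sum_const, smul_eq_mul]
    intro i hi
    rw [Finset.mem_filter] at hi
    simp [letterSize, hi.2]
  · rw [Finset.sum_congr rfl (g := fun _ => k), Finset.sum_const, smul_eq_mul]
    intro i hi
    rw [Finset.mem_filter] at hi
    have : pos i = false := by simpa using hi.2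
    simp [letterSize, this]

end Letters

/-! ### Claim 17: Diophantine approximation of `1/√2` -/

section Claim17

/-- `p² ≠ 2 q²` for naturals not both zero (irrationality of `√2`). [folklore] -/
theorem sq_ne_two_mul_sq {p q : ℕ} (h : p ≠ 0 ∨ q ≠ 0) : (p : ℝ) ^ 2 ≠ 2 * (q : ℝ) ^ 2 := by
  intro heq
  rcases Nat.eq_zero_or_pos q with hq | hq
  · subst hq
    simp only [Nat.cast_zero, ne_eq, zero_pow, OfNat.ofNat_ne_zero, not_false_eq_true,
      mul_zero, pow_eq_zero_iff] at heq
    have hp : p = 0 := by exact_mod_cast heq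
    rcases h with h | h
    · exact h hp
    · exact h rfl
  · have hq' : (0 : ℝ) < q := Nat.cast_pos.2 hq
    have h2 : Real.sqrt 2 = p / q := by
      rw [← Real.sqrt_sq (div_nonneg (Nat.cast_nonneg p) hq'.le), div_pow, heq,
        mul_div_assoc, div_self (pow_ne_zero 2 hq'.ne'), mul_one]
    exact irrational_sqrt_two.ne_rat (p / q) (by rw [h2]; push_cast; rfl)

/-- **Claim 17** (LST 2025, p. 26:14): for naturals `p, q` not both zero,
`|p α - q| ≥ 1/(4 p α + 2)` with `α = 1/√2`. Proof as printed: if `q ≥ p α + 1` the bound is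
immediate; otherwise `|pα - q| · |pα + q| = |p²/2 - q²| ≥ 1/2` and `|pα + q| ≤ 2pα + 1`.
[cite: LimayeSrinivasanTavenas2025, Claim 17] -/
theorem abs_sub_ge_claim17 {p q : ℕ} (h : p ≠ 0 ∨ q ≠ 0) :
    1 / (4 * (p : ℝ) / Real.sqrt 2 + 2) ≤ |(p : ℝ) / Real.sqrt 2 - q| := by
  set a : ℝ := (p : ℝ) / Real.sqrt 2 with ha
  have ha0 : 0 ≤ a := div_nonneg (Nat.cast_nonneg p) sqrt_two_pos.le
  have hden : 0 < 4 * (p : ℝ) / Real.sqrt 2 + 2 := by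
    have : 0 ≤ 4 * (p : ℝ) / Real.sqrt 2 := by positivity
    linarith
  have hden' : 4 * (p : ℝ) / Real.sqrt 2 + 2 = 2 * (2 * a + 1) := by rw [ha]; ring
  by_cases hq : a + 1 ≤ q
  · -- `|a - q| ≥ 1 ≥ 1/(…)`
    have h1 : 1 ≤ |a - (q : ℝ)| := by
      rw [abs_sub_comm, abs_of_nonneg (by linarith)]
      linarith
    refine le_trans ?_ h1
    rw [div_le_one hden]
    have : 0 ≤ 4 * (p : ℝ) / Real.sqrt 2 := by positivity
    linarith
  · push Not at hq
    -- `|a - q| · |a + q| = |a² - q²| = |p² - 2 q²| / 2 ≥ 1/2`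
    have hprod : 1 / 2 ≤ |a - q| * |a + q| := by
      rw [← abs_mul, show (a - q) * (a + q) = a ^ 2 - (q : ℝ) ^ 2 by ring]
      have hsq : a ^ 2 = (p : ℝ) ^ 2 / 2 := by
        rw [ha, div_pow, Real.sq_sqrt (by norm_num)]
      rw [hsq]
      -- `p² - 2q²` is a nonzero integer
      set z : ℤ := (p : ℤ) ^ 2 - 2 * (q : ℤ) ^ 2 with hz
      have hint : z ≠ 0 := by
        intro h0
        apply sq_ne_two_mul_sq h
        have h0' : ((p : ℤ) ^ 2 : ℤ) = 2 * (q : ℤ) ^ 2 := by rw [hz, sub_eq_zero] at h0; exact h0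
        have := congrArg (fun t : ℤ => (t : ℝ)) h0'
        push_cast at this
        exact this
      have habs : (1 : ℝ) ≤ |(z : ℝ)| := by
        rw [← Int.cast_abs]
        exact_mod_cast Int.one_le_abs hint
      have hzr : (p : ℝ) ^ 2 / 2 - (q : ℝ) ^ 2 = (z : ℝ) / 2 := by
        rw [hz]; push_cast; ring
      rw [hzr, abs_div, abs_of_pos (by norm_num : (0 : ℝ) < 2)]
      linarith
    have hsum : |a + q| ≤ 2 * a + 1 := by
      rw [abs_of_nonneg (by positivity)]
      linarith
    have hsum_pos : 0 < 2 * a + 1 := by linarith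
    have hmul := mul_le_mul_of_nonneg_left hsum (abs_nonneg (a - q))
    rw [hden', div_le_iff₀ (by positivity)]
    linarith

end Claim17

/-! ### `|w_S| ≥ k/(5 #S) - #S` -/

section WordBounds

/-- **The imbalance of small block sets** (LST 2025, proof of Claim 16, pp. 26:14–26:15): for a
nonempty set `S` of positions with `p` positive and `q` negative letters,
`|w_S| = |p ⌊αk⌋ - q k| ≥ k |pα - q| - p ≥ k/(4pα + 2) - p ≥ k/(5 #S) - #S`.
[cite: LimayeSrinivasanTavenas2025, Claim 16] -/
theorem abs_wsum_ge {d : ℕ} (k : ℕ) (pos : Fin d → Bool) {S : Finset (Fin d)} (hS : S.Nonempty) :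
    (k : ℝ) / (5 * S.card) - S.card ≤ |(wsum k pos S : ℝ)| := by
  set p := (S.filter fun i => pos i).card with hp
  set q := (S.filter fun i => !pos i).card with hq
  have hpq : p + q = S.card := by
    rw [hp, hq]
    have := Finset.card_filter_add_card_filter_not (s := S) (fun i => pos i = true)
    convert this using 3
    ext i; simp
  have hcard : 0 < S.card := Finset.card_pos.2 hS
  have hne : p ≠ 0 ∨ q ≠ 0 := by omega
  have hw : (wsum k pos S : ℝ) = p * (posLetter k : ℝ) - q * (k : ℝ) := by
    rw [wsum_eq_card_sub_card]; push_cast; rfl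
  set a : ℝ := (p : ℝ) / Real.sqrt 2 with ha
  have ha0 : 0 ≤ a := div_nonneg (Nat.cast_nonneg p) sqrt_two_pos.le
  -- `|w_S| ≥ k |pα - q| - p`
  have hfloor : |(p : ℝ) * posLetter k - p * (k / Real.sqrt 2)| ≤ p := by
    rw [← mul_sub, abs_mul, abs_of_nonneg (Nat.cast_nonneg p)]
    refine mul_le_of_le_one_right (Nat.cast_nonneg p) ?_
    rw [abs_sub_comm, abs_of_nonneg (sub_nonneg.2 (posLetter_le_div k))]
    have := sub_one_lt_posLetter k
    linarith
  have hmain : (k : ℝ) * |a - q| - p ≤ |(wsum k pos S : ℝ)| := by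
    rw [hw]
    have hk : (k : ℝ) * |a - q| = |p * (k / Real.sqrt 2) - q * k| := by
      rw [show (p : ℝ) * (k / Real.sqrt 2) - q * k = k * (a - q) by rw [ha]; ring, abs_mul,
        abs_of_nonneg (Nat.cast_nonneg (α := ℝ) k)]
    rw [hk]
    have := abs_sub_abs_le_abs_sub (p * (k / Real.sqrt 2) - q * (k : ℝ))
      (p * (posLetter k : ℝ) - q * k)
    rw [show p * (k / Real.sqrt 2) - q * (k : ℝ) - (p * (posLetter k : ℝ) - q * k) =
      -(p * (posLetter k : ℝ) - p * (k / Real.sqrt 2)) by ring, abs_neg] at this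
    linarith
  -- Claim 17 and `4pα + 2 ≤ 5 #S`
  have h17 := abs_sub_ge_claim17 hne
  have hden : 0 < 4 * (p : ℝ) / Real.sqrt 2 + 2 := by
    have : 0 ≤ 4 * (p : ℝ) / Real.sqrt 2 := by positivity
    linarith
  have hden_le : 4 * (p : ℝ) / Real.sqrt 2 + 2 ≤ 5 * S.card := by
    have hpS : (p : ℝ) ≤ S.card := by exact_mod_cast (show p ≤ S.card by omega)
    have hS1 : (1 : ℝ) ≤ S.card := by exact_mod_cast hcard
    have h4 : 4 * (p : ℝ) / Real.sqrt 2 ≤ 3 * p := by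
      rw [div_le_iff₀ sqrt_two_pos]
      nlinarith [four_thirds_lt_sqrt_two, Nat.cast_nonneg (α := ℝ) p]
    linarith
  have hkS : (k : ℝ) / (5 * S.card) ≤ k * |a - q| := by
    calc (k : ℝ) / (5 * S.card) ≤ k / (4 * (p : ℝ) / Real.sqrt 2 + 2) :=
          div_le_div_of_nonneg_left (Nat.cast_nonneg k) hden hden_le
      _ = k * (1 / (4 * (p : ℝ) / Real.sqrt 2 + 2)) := by rw [mul_one_div]
      _ ≤ k * |a - q| := mul_le_mul_of_nonneg_left h17 (Nat.cast_nonneg k)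
  have hpS : (p : ℝ) ≤ S.card := by exact_mod_cast (show p ≤ S.card by omega)
  linarith

/-- The form used at each level of the induction (LST 2025, p. 26:15, "the last inequality
follows from the fact that `k ≥ 10 T²`"): if `k ≥ 10 #S²` then `|w_S| ≥ k/(10 #S)`.
[cite: LimayeSrinivasanTavenas2025, Claim 16] -/
theorem abs_wsum_ge_of_le {d : ℕ} (k : ℕ) (pos : Fin d → Bool) {S : Finset (Fin d)}
    (hS : S.Nonempty) (hk : 10 * (S.card : ℝ) ^ 2 ≤ k) :
    (k : ℝ) / (10 * S.card) ≤ |(wsum k pos S : ℝ)| := by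
  refine le_trans ?_ (abs_wsum_ge k pos hS)
  have hc : (0 : ℝ) < S.card := by exact_mod_cast Finset.card_pos.2 hS
  rw [le_sub_iff_add_le, div_add' _ _ _ (by positivity), div_le_div_iff₀ (by positivity)
    (by positivity)]
  nlinarith

end WordBounds

/-! ### The greedy `k`-unbiased word -/

section Greedy

/-- The running prefix sum of the greedy word (LST 2025, proof of Lemma 13, p. 26:12): start at
`0`; add `⌊k/√2⌋` if the current sum is `≤ 0`, else add `-k`.
[cite: LimayeSrinivasanTavenas2025, Lemma 13] -/
def greedyAcc (k : ℕ) : ℕ → ℤ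
  | 0 => 0
  | t + 1 => greedyAcc k t + (if greedyAcc k t ≤ 0 then (posLetter k : ℤ) else -(k : ℤ))

/-- The greedy word of length `d`: position `i` is positive iff the prefix sum before it is
`≤ 0` (LST 2025, proof of Lemma 13: "if `|w_{[i]}| ≤ 0` we choose `w_{i+1} = k - k/√d`" — here
with the alphabet of Claim 16). [cite: LimayeSrinivasanTavenas2025, Lemma 15] -/
def greedyWord (d k : ℕ) : Fin d → Bool := fun i => decide (greedyAcc k i ≤ 0)

/-- The prefix sums of the greedy word stay in `[-k, ⌊k/√2⌋]`.
[cite: LimayeSrinivasanTavenas2025, Lemma 15] -/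
theorem greedyAcc_mem (k t : ℕ) : -(k : ℤ) ≤ greedyAcc k t ∧ greedyAcc k t ≤ posLetter k := by
  induction t with
  | zero =>
    simp only [greedyAcc]
    constructor
    · omega
    · positivity
  | succ t ih =>
    simp only [greedyAcc]
    have hpk : (posLetter k : ℤ) ≤ k := by exact_mod_cast posLetter_le k
    split_ifs with h
    · constructor <;> omega
    · constructor <;> omega

/-- Prefix sums of the greedy word are the running sums `greedyAcc`.
[cite: LimayeSrinivasanTavenas2025, Lemma 15] -/
theorem wsum_greedyWord_prefix (d k t : ℕ) (ht : t ≤ d) :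
    wsum k (greedyWord d k) (Finset.univ.filter fun i : Fin d => (i : ℕ) < t) = greedyAcc k t := by
  induction t with
  | zero => simp [wsum, greedyAcc]
  | succ t ih =>
    have ht' : t < d := Nat.lt_of_succ_le ht
    have hsplit : (Finset.univ.filter fun i : Fin d => (i : ℕ) < t + 1) =
        insert ⟨t, ht'⟩ (Finset.univ.filter fun i : Fin d => (i : ℕ) < t) := by
      ext i
      simp only [Finset.mem_filter, Finset.mem_univ, true_and, Finset.mem_insert, Fin.ext_iff]
      omega
    have hnot : (⟨t, ht'⟩ : Fin d) ∉ (Finset.univ.filter fun i : Fin d => (i : ℕ) < t) := by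
      simp
    rw [wsum, hsplit, Finset.sum_insert hnot, ← wsum, ih ht'.le, greedyAcc, add_comm]
    congr 1
    simp [wt, greedyWord]

/-- **The greedy word is `k`-unbiased** (LST 2025, §2: `w` is `b`-unbiased if `|w_{[t]}| ≤ b` for
every `t ≤ d`; proof of Lemma 15, p. 26:14: "we can fix a word `w` over the alphabet
`{⌊αk⌋, -k}` such that `w` is `k`-unbiased"). [cite: LimayeSrinivasanTavenas2025, Lemma 15] -/
theorem abs_prefixSum_greedyWord_le (d k t : ℕ) (ht : t ≤ d) :
    |wsum k (greedyWord d k) (Finset.univ.filter fun i : Fin d => (i : ℕ) < t)| ≤ k := by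
  rw [wsum_greedyWord_prefix d k t ht, abs_le]
  have h := greedyAcc_mem k t
  have hpk : (posLetter k : ℤ) ≤ k := by exact_mod_cast posLetter_le k
  constructor <;> omega

/-- In particular the whole greedy word has `|w_{[d]}| ≤ k`.
[cite: LimayeSrinivasanTavenas2025, Lemma 15] -/
theorem abs_wsum_greedyWord_univ_le (d k : ℕ) :
    |wsum k (greedyWord d k) Finset.univ| ≤ k := by
  have h := abs_prefixSum_greedyWord_le d k d le_rfl
  have huniv : (Finset.univ.filter fun i : Fin d => (i : ℕ) < d) = Finset.univ := by
    ext i; simp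
  rwa [huniv] at h

/-- The natural-number prefix length `|w_{[t]}|` of the greedy word (the number of overhanging
bits after `t` letters) is at most `k`. [cite: LimayeSrinivasanTavenas2025, Lemma 15] -/
theorem natAbs_greedyAcc_le (k t : ℕ) : (greedyAcc k t).natAbs ≤ k := by
  have h := greedyAcc_mem k t
  have hpk : (posLetter k : ℤ) ≤ k := by exact_mod_cast posLetter_le k
  omega

end Greedy

end LSTWord

end Literature.Computability.AlgebraicComplexity
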